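import Literature.NumberTheory.Automorphic.UnitaryGroupTruncatedKernelIntegrableOfCusp
import Literature.NumberTheory.Automorphic.UnitaryGroupTruncatedKernelClassMeasurable
import Literature.NumberTheory.Automorphic.UnitaryGroupKernelFiniteSum
import HarnessLib

/-!
# Integrability of the CLASS truncated kernels `k^T_𝔬` on `U(3)` REDUCED TO THE per-class CUSP ESTIMATE
(Rogawski, *Automorphic Representations of Unitary Groups in Three Variables* (1990), §2.2 p. 13:
«Furthermore, `k^T_𝔬` is integrable over `𝐙G\𝐆`»; Arthur, Duke Math. J. 45 (1978), Thm. 7.1 — stated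
class by class; Gelbart (1975), §9.B for `GL₂`)

Topic `NumberTheory/Automorphic`; namespace `Literature.NumberTheory.Automorphic.UnitaryGroup`. Proof file:
theorems only (no definition, no named fact, no instance, no `sorry`). The CLASS REPLAY (LAW 3 = the
`𝔬`-expansion road of the T1-qs sub-line, cell `hodgecm-mathlib`, crux H413; brick H8a-𝔬) of ★
`UnitaryGroupTruncatedKernelIntegrableOfCusp` for an ARBITRARY class map `cl : G(F) → ι` satisfying
Rogawski's two partition axioms ★ `IsConjInvariant cl`, ★ `IsUnipotentInvariantOnBorel cl`
(★ `UnitaryGroupArthurKernelClassExpansion`; instance of record ★ `UnitaryGroupCharpolyClassMap`), class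
kernels `K_𝔬 = kernelClass cl i f`, `K_{B,𝔬} = kernelBorelClass ν 𝓕 cl i f`, `k^T_𝔬 = truncatedKernelClass ν 𝓕 T cl i f`.

* §1 `exists_forall_norm_kernelClass_le` — `|K_𝔬(g, g)| ≤ Σ_γ |f(g⁻¹ γ g)|` is bounded on the Mahler region,
  ONE constant for every class map and class (★ `exists_forall_norm_kernel_le` applied to `|f| ∈ C_c`).
* §2 `enorm_truncatedKernelClass_le_of_dichotomy` — `‖k^T_𝔬(y)‖ ≤ C_T + Σ_{γ ∈ G(F)} (1_{D ∩ {H > T}} ·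
  ‖K_𝔬 − K_{B,𝔬}‖)(γ y)` (`T ≥ 1`), word for word as ★ H8a: below the cut-off `k^T_𝔬 = K_𝔬` (★
  `truncatedKernelClass_eq_kernelClass_of_forall_le`) on the Mahler region (★
  `forall_inv_le_vecHeight_of_forall_borelHeight_le`); otherwise ONE class `B(F)γ₀` is above the cut-off
  (Siegel ★ `borelHeight_mul_lt_one_of_not_mem_arithmeticBorel`), `k^T_𝔬(y) = K_𝔬(z,z) − K_{B,𝔬}(z,z)` at
  `z = γ₀ y` (★ `kernelClass_diag_rational_mul` — `IsConjInvariant`; ★ `kernelBorelClass_diag_rational_borel_mul`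
  — `IsUnipotentInvariantOnBorel`, to move `z` into `D`).
* §3 **`integrable_quotFun_truncatedKernelClass_of_cusp_estimate`** — for ONE class `𝔬 = i`: `[g] ↦ k^T_𝔬(g⁻¹)`
  is `μ`-integrable for `T > T₀` as soon as (i) `U(J₃)(𝔸_F)` is unimodular and (ii) the per-class CUSP
  ESTIMATE `∫⁻_{D ∩ {T < H}} ‖K_𝔬 − K_{B,𝔬}‖ₑ dν_G < ∞` holds on some Borel `D` meeting every `B(F)`-orbit
  (Weil's formula ★ `LevelOrbit.lintegral_fiberLIntegral_count_eq`, inversion invariance of `ν_G`;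
  measurability ★ `aestronglyMeasurable_quotFun_truncatedKernelClass`).

HC_CM is proved only modulo the 7 printed citations until rung 0 closes.

## References

* J. D. Rogawski, *Automorphic Representations of Unitary Groups in Three Variables* (1990), §2.2 [Rogawski1990].
* S. Gelbart, *Automorphic forms on adele groups* (1975), §9.B [Gelbart1975].
* S. Shokranian, *The Selberg–Arthur Trace Formula*, LNM 1503 (1992), §5.1–§5.2 [Shokranian1992].
-/

set_option autoImplicit false

noncomputable section

open MeasureTheory Measure NumberField IsDedekindDomain Set Matrix
open Literature.MeasureTheory.Group
open scoped NNReal ENNReal Pointwise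

namespace Literature.NumberTheory.Automorphic

namespace UnitaryGroup

variable {F E : Type} [Field F] [NumberField F] [Field E] [NumberField E] [Algebra F E]
  {c : E ≃ₐ[F] E} {ι : Type*}

/-- `𝔸_E` is Hausdorff (local copy of the standard argument). [folklore] -/
private theorem t2Space_adeleRing_E₁₀ : T2Space (AdeleRing (𝓞 E) E) := by
  haveI : T2Space (FiniteAdeleRing (𝓞 E) E) := inferInstanceAs <| T2Space
    (RestrictedProduct (fun w : IsDedekindDomain.HeightOneSpectrum (𝓞 E) => w.adicCompletion E)
      (fun w => (w.adicCompletionIntegers E : Set (w.adicCompletion E))) Filter.cofinite)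
  haveI : T2Space (InfiniteAdeleRing E) :=
    inferInstanceAs <| T2Space ((w : InfinitePlace E) → w.Completion)
  exact inferInstanceAs <| T2Space (InfiniteAdeleRing E × FiniteAdeleRing (𝓞 E) E)

/-! ## §1 `K_𝔬(g, g)` is bounded on the Mahler region, uniformly in the class -/

section Mahler

variable {N : ℕ}

/-- **`|K_𝔬(x, y)| ≤ Σ_{γ ∈ G(F)} |f(x⁻¹ γ y)|`** for `f` of compact support: the class sum is a
sub-sum of the absolutely convergent (finite) kernel sum of `|f|` (★ `finite_support_kernel_term`).
[cite: Rogawski1990, §2.2 (p. 13)] -/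
theorem norm_kernelClass_le_tsum_norm (cl : (quasiSplit F E c N).arithmeticSubgroup → ι) (i : ι)
    {f : (quasiSplit F E c N).Adelic → ℂ} (hf : HasCompactSupport f) (x y : (quasiSplit F E c N).Adelic) :
    ‖kernelClass cl i f x y‖ ≤ ∑' γ : (quasiSplit F E c N).arithmeticSubgroup,
      ‖f (x⁻¹ * (γ : (quasiSplit F E c N).Adelic) * y)‖ := by
  have hsum : Summable fun γ : (quasiSplit F E c N).arithmeticSubgroup =>
      ‖f (x⁻¹ * (γ : (quasiSplit F E c N).Adelic) * y)‖ :=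
    (summable_kernel_of_hasCompactSupport hf x y).norm
  rw [kernelClass_def]
  refine (norm_tsum_le_tsum_norm (hsum.subtype _)).trans ?_
  exact Summable.tsum_subtype_le (fun γ : (quasiSplit F E c N).arithmeticSubgroup =>
    ‖f (x⁻¹ * (γ : (quasiSplit F E c N).Adelic) * y)‖) _ (fun _ => norm_nonneg _) hsum

/-- The kernel of `|f|` (as a `ℂ`-valued function) at `(x, y)` has norm `Σ_γ |f(x⁻¹ γ y)|`.
[cite: Rogawski1990, §2.2 (p. 13)] -/
theorem norm_kernel_ofReal_norm {f : (quasiSplit F E c N).Adelic → ℂ} (hf : HasCompactSupport f)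
    (x y : (quasiSplit F E c N).Adelic) :
    ‖kernel (fun g => ((‖f g‖ : ℝ) : ℂ)) x y‖ = ∑' γ : (quasiSplit F E c N).arithmeticSubgroup,
      ‖f (x⁻¹ * (γ : (quasiSplit F E c N).Adelic) * y)‖ := by
  have hsum : Summable fun γ : (quasiSplit F E c N).arithmeticSubgroup =>
      ‖f (x⁻¹ * (γ : (quasiSplit F E c N).Adelic) * y)‖ :=
    (summable_kernel_of_hasCompactSupport hf x y).norm
  rw [kernel_def]
  have h : (∑' γ : (quasiSplit F E c N).arithmeticSubgroup,
      (((‖f (x⁻¹ * (γ : (quasiSplit F E c N).Adelic) * y)‖ : ℝ) : ℂ))) =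
      (((∑' γ : (quasiSplit F E c N).arithmeticSubgroup,
        ‖f (x⁻¹ * (γ : (quasiSplit F E c N).Adelic) * y)‖ : ℝ)) : ℂ) :=
    (Complex.ofReal_tsum _).symm
  rw [h, Complex.norm_real, Real.norm_of_nonneg (tsum_nonneg fun _ => norm_nonneg _)]

/-- **`K_𝔬(g, g)` is bounded on the Mahler region**, with ONE constant for every class map and every
class: `|K_𝔬(g, g)| ≤ Σ_γ |f(g⁻¹ γ g)| = K^{|f|}(g, g)`, and the latter is bounded on the Mahler region
of level `ε` by ★ `exists_forall_norm_kernel_le` applied to `|f| ∈ C_c`. [cite: Rogawski1990, §2.2 (p. 13)] -/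
theorem exists_forall_norm_kernelClass_le {ε : ℝ≥0} (hε : 0 < ε) {f : (quasiSplit F E c N).Adelic → ℂ}
    (hfc : Continuous f) (hf : HasCompactSupport f) :
    ∃ Cb : ℝ, ∀ (cl : (quasiSplit F E c N).arithmeticSubgroup → ι) (i : ι) (g : (quasiSplit F E c N).Adelic),
      (∀ ξ : Fin N → E, ξ ≠ 0 →
        ε ≤ vecHeight E (principalVec E ξ ᵥ* (adelicVal F E c N _ g : Matrix (Fin N) (Fin N) (AdeleRing (𝓞 E) E)))) →
      ‖kernelClass cl i f g g‖ ≤ Cb := by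
  have hFc : Continuous fun g : (quasiSplit F E c N).Adelic => ((‖f g‖ : ℝ) : ℂ) :=
    Complex.continuous_ofReal.comp (continuous_norm.comp hfc)
  have hFs : HasCompactSupport fun g : (quasiSplit F E c N).Adelic => ((‖f g‖ : ℝ) : ℂ) := by
    refine hf.mono ?_
    intro g hg
    rw [Function.mem_support, ne_eq, Complex.ofReal_eq_zero, norm_eq_zero] at hg
    exact hg
  obtain ⟨Cb, hCb⟩ := exists_forall_norm_kernel_le (F := F) (E := E) (c := c) (N := N) hε hFc hFs
  refine ⟨Cb, fun cl i g hg => ?_⟩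
  calc ‖kernelClass cl i f g g‖
      ≤ ∑' γ : (quasiSplit F E c N).arithmeticSubgroup, ‖f (g⁻¹ * (γ : (quasiSplit F E c N).Adelic) * g)‖ :=
        norm_kernelClass_le_tsum_norm cl i hf g g
    _ = ‖kernel (fun g' => ((‖f g'‖ : ℝ) : ℂ)) g g‖ := (norm_kernel_ofReal_norm hf g g).symm
    _ ≤ Cb := hCb g hg

end Mahler

/-! ## §2 The pointwise dichotomy for `k^T_𝔬` on `U(3)` -/

section Three

variable [MeasurableSpace (adelicUnipotent F E c 3)] [BorelSpace (adelicUnipotent F E c 3)]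

/-- **THE POINTWISE DICHOTOMY BOUND, class by class** (`cl` with Rogawski's two partition axioms,
`T ≥ 1`, `ν` Haar, `𝓕` a fundamental domain of `N(F)`, `C` a bound for `|K_𝔬(y, y)|` on the Mahler region
of level `T⁻¹`, `D` meeting every `B(F)`-orbit): `‖k^T_𝔬(y)‖ ≤ C + Σ'_{γ ∈ G(F)} (1_{D ∩ {H > T}} ‖K_𝔬 − K_{B,𝔬}‖)(γ y)`.
[cite: Rogawski1990, §2.2 (p. 13)] -/
theorem enorm_truncatedKernelClass_le_of_dichotomy (hc : c * c = 1) (ν : Measure (adelicUnipotent F E c 3))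
    [ν.IsHaarMeasure] {𝓕 : Set (adelicUnipotent F E c 3)}
    (h𝓕 : IsFundamentalDomain (rationalUnipotent F E c 3) 𝓕 ν)
    {cl : (quasiSplit F E c 3).arithmeticSubgroup → ι} (hcl : IsConjInvariant cl)
    (hclN : IsUnipotentInvariantOnBorel F E c 3 cl) (i : ι)
    (f : (quasiSplit F E c 3).Adelic → ℂ) {T : ℝ≥0} (hT : 1 ≤ T) {C : ℝ}
    (hC : ∀ g : (quasiSplit F E c 3).Adelic,
      (∀ ξ : Fin 3 → E, ξ ≠ 0 →
        T⁻¹ ≤ vecHeight E (principalVec E ξ ᵥ* (adelicVal F E c 3 _ g : Matrix (Fin 3) (Fin 3) (AdeleRing (𝓞 E) E)))) →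
      ‖kernelClass cl i f g g‖ ≤ C)
    {D : Set (quasiSplit F E c 3).Adelic}
    (hD : ∀ g : (quasiSplit F E c 3).Adelic, ∃ β : (quasiSplit F E c 3).arithmeticSubgroup,
      β ∈ arithmeticBorel F E c 3 ∧ (β : (quasiSplit F E c 3).Adelic) * g ∈ D)
    (y : (quasiSplit F E c 3).Adelic) :
    ‖truncatedKernelClass ν 𝓕 T cl i f y‖ₑ ≤ ENNReal.ofReal C +
      ∑' γ : (quasiSplit F E c 3).arithmeticSubgroup,
        (D ∩ {g | T < borelHeight g}).indicator
          (fun g => (‖kernelClass cl i f g g - kernelBorelClass ν 𝓕 cl i f g g‖ₑ : ℝ≥0∞))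
          ((γ : (quasiSplit F E c 3).Adelic) * y) := by
  classical
  by_cases hex : ∃ γ : (quasiSplit F E c 3).arithmeticSubgroup,
      T < borelHeight ((γ : (quasiSplit F E c 3).Adelic) * y)
  · -- exactly one class above the cut-off
    obtain ⟨γ₀, hγ₀⟩ := hex
    have hT1 : 1 < borelHeight ((γ₀ : (quasiSplit F E c 3).Adelic) * y) := lt_of_le_of_lt hT hγ₀
    set q₀ : Quotient (QuotientGroup.rightRel (arithmeticBorel F E c 3)) := Quotient.mk _ γ₀ with hq₀
    have huniq : ∀ q : Quotient (QuotientGroup.rightRel (arithmeticBorel F E c 3)),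
        T < borelHeight (((q.out : (quasiSplit F E c 3).arithmeticSubgroup) : (quasiSplit F E c 3).Adelic) * y) →
          q = q₀ := by
      intro q hq
      set δ : (quasiSplit F E c 3).arithmeticSubgroup := q.out * γ₀⁻¹ with hδ
      have hqout : ((q.out : (quasiSplit F E c 3).arithmeticSubgroup) : (quasiSplit F E c 3).Adelic) * y =
          (δ : (quasiSplit F E c 3).Adelic) * (((γ₀ : (quasiSplit F E c 3).Adelic)) * y) := by
        rw [hδ, Subgroup.coe_mul, Subgroup.coe_inv]; group
      have hδB : δ ∈ arithmeticBorel F E c 3 := by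
        by_contra hδB
        have hlt := borelHeight_mul_lt_one_of_not_mem_arithmeticBorel hδB hT1
        rw [← hqout] at hlt
        exact absurd (hT.trans hq.le) (not_le.2 hlt)
      rw [hq₀]
      rw [← Quotient.out_eq q]
      exact Quotient.sound (QuotientGroup.rightRel_apply.2 (by
        rw [show γ₀ * (q.out : (quasiSplit F E c 3).arithmeticSubgroup)⁻¹ = δ⁻¹ by
          rw [hδ, _root_.mul_inv_rev, inv_inv]]
        exact inv_mem hδB))
    set z : (quasiSplit F E c 3).Adelic :=
      ((q₀.out : (quasiSplit F E c 3).arithmeticSubgroup) : (quasiSplit F E c 3).Adelic) * y with hz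
    have hβ₀ : (q₀.out : (quasiSplit F E c 3).arithmeticSubgroup) * γ₀⁻¹ ∈ arithmeticBorel F E c 3 := by
      have h : @Setoid.r _ (QuotientGroup.rightRel (arithmeticBorel F E c 3)) q₀.out γ₀ :=
        Quotient.mk_out (s := QuotientGroup.rightRel (arithmeticBorel F E c 3)) γ₀
      have h' := QuotientGroup.rightRel_apply.1 h
      rw [show (q₀.out : (quasiSplit F E c 3).arithmeticSubgroup) * γ₀⁻¹ =
        (γ₀ * (q₀.out : (quasiSplit F E c 3).arithmeticSubgroup)⁻¹)⁻¹ by rw [_root_.mul_inv_rev, inv_inv]]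
      exact inv_mem h'
    have hzT : T < borelHeight z := by
      have hz' : z = (((q₀.out * γ₀⁻¹ : (quasiSplit F E c 3).arithmeticSubgroup)) : (quasiSplit F E c 3).Adelic) *
          (((γ₀ : (quasiSplit F E c 3).Adelic)) * y) := by
        rw [hz, Subgroup.coe_mul, Subgroup.coe_inv]; group
      obtain ⟨b₀, hb₀⟩ := MonoidHom.mem_range.mp (q₀.out * γ₀⁻¹).2
      rw [hz', ← hb₀, borelHeight_rational_borel_mul b₀ (by
        rw [hb₀]; exact (mem_arithmeticBorel_iff _).1 hβ₀)]
      exact hγ₀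
    -- `k^T_𝔬(y) = K_𝔬(y,y) − K_{B,𝔬}(z,z) = K_𝔬(z,z) − K_{B,𝔬}(z,z)`
    have hsum : pseudoEisenstein (kernelBorelTailClass ν 𝓕 T cl i f) y = kernelBorelClass ν 𝓕 cl i f z z := by
      rw [pseudoEisenstein_def, finsum_eq_single _ q₀]
      · exact kernelBorelTailClass_of_lt cl i f hzT
      · intro q hq
        by_contra hne
        have hlt : T < borelHeight (((q.out : (quasiSplit F E c 3).arithmeticSubgroup) :
            (quasiSplit F E c 3).Adelic) * y) := by
          by_contra hle
          exact hne (kernelBorelTailClass_of_not_lt cl i f hle)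
        exact hq (huniq q hlt)
    have hkT : truncatedKernelClass ν 𝓕 T cl i f y = kernelClass cl i f z z - kernelBorelClass ν 𝓕 cl i f z z := by
      rw [truncatedKernelClass_def, hsum, hz, kernelClass_diag_rational_mul hcl]
    obtain ⟨β, hβB, hβD⟩ := hD z
    have hzβ : kernelClass cl i f z z - kernelBorelClass ν 𝓕 cl i f z z =
        kernelClass cl i f ((β : (quasiSplit F E c 3).Adelic) * z) ((β : (quasiSplit F E c 3).Adelic) * z) -
          kernelBorelClass ν 𝓕 cl i f ((β : (quasiSplit F E c 3).Adelic) * z)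
            ((β : (quasiSplit F E c 3).Adelic) * z) := by
      rw [kernelClass_diag_rational_mul hcl i f β z z,
        kernelBorelClass_diag_rational_borel_mul hcl hclN ν h𝓕 i f β hβB z]
    have hβzT : T < borelHeight ((β : (quasiSplit F E c 3).Adelic) * z) := by
      obtain ⟨b, hb⟩ := MonoidHom.mem_range.mp β.2
      rw [← hb, borelHeight_rational_borel_mul b (by rw [hb]; exact (mem_arithmeticBorel_iff _).1 hβB)]
      exact hzT
    set γ' : (quasiSplit F E c 3).arithmeticSubgroup := β * q₀.out with hγ'
    have hγ'y : (γ' : (quasiSplit F E c 3).Adelic) * y = (β : (quasiSplit F E c 3).Adelic) * z := by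
      rw [hγ', Subgroup.coe_mul, hz, mul_assoc]
    have hterm : (‖truncatedKernelClass ν 𝓕 T cl i f y‖ₑ : ℝ≥0∞) =
        (D ∩ {g | T < borelHeight g}).indicator
          (fun g => (‖kernelClass cl i f g g - kernelBorelClass ν 𝓕 cl i f g g‖ₑ : ℝ≥0∞))
          ((γ' : (quasiSplit F E c 3).Adelic) * y) := by
      rw [hγ'y, Set.indicator_of_mem (Set.mem_inter hβD hβzT), hkT, hzβ]
    calc (‖truncatedKernelClass ν 𝓕 T cl i f y‖ₑ : ℝ≥0∞)
        ≤ ∑' γ : (quasiSplit F E c 3).arithmeticSubgroup,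
            (D ∩ {g | T < borelHeight g}).indicator
              (fun g => (‖kernelClass cl i f g g - kernelBorelClass ν 𝓕 cl i f g g‖ₑ : ℝ≥0∞))
              ((γ : (quasiSplit F E c 3).Adelic) * y) := by rw [hterm]; exact ENNReal.le_tsum γ'
      _ ≤ _ := le_add_self
  · -- no class above the cut-off: `k^T_𝔬 = K_𝔬` and `y` in the Mahler region
    rw [not_exists] at hex
    have hle : ∀ γ : (quasiSplit F E c 3).arithmeticSubgroup,
        borelHeight ((γ : (quasiSplit F E c 3).Adelic) * y) ≤ T := fun γ => not_lt.1 (hex γ)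
    rw [truncatedKernelClass_eq_kernelClass_of_forall_le cl i f hle]
    have hK : ‖kernelClass cl i f y y‖ ≤ C := hC y (forall_inv_le_vecHeight_of_forall_borelHeight_le hc hT hle)
    calc (‖kernelClass cl i f y y‖ₑ : ℝ≥0∞) ≤ ENNReal.ofReal C := by
          rw [← ofReal_norm]; exact ENNReal.ofReal_le_ofReal hK
      _ ≤ _ := le_self_add

end Three

/-! ## §3 The assembly modulo the per-class cusp estimate -/

/-- **INTEGRABILITY OF `k^T_𝔬` FROM THE per-class CUSP ESTIMATE** (Rogawski (1990), §2.2 p. 13: «`k^T_𝔬` is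
integrable over `𝐙G\𝐆`»; Arthur (1978), Thm. 7.1): for `cl` with Rogawski's two partition axioms and ONE class
`𝔬 = i`, for every Haar `ν` on `N(𝔸_F)`, fundamental domain `𝓕` of `N(F)`, automorphic `μ` and test `f`, the
descended `[g] ↦ k^T_𝔬(g⁻¹)` is `μ`-integrable for `T > T₀`, provided (i) `U(J₃)(𝔸_F)` is unimodular and
(ii) the per-class cusp estimate `∫⁻_{D ∩ {T < H}} ‖K_𝔬(g,g) − K_{B,𝔬}(g,g)‖ₑ dν_G < ∞` on a Borel `D`
meeting every `B(F)`-orbit. [cite: Rogawski1990, §2.2 (p. 13)] [cite: Gelbart1975, §9.B (9.44)–(9.46)] -/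
theorem integrable_quotFun_truncatedKernelClass_of_cusp_estimate (hc : c * c = 1)
    (hunimod : ∀ [MeasurableSpace (quasiSplit F E c 3).Adelic] [BorelSpace (quasiSplit F E c 3).Adelic]
      (νG : Measure (quasiSplit F E c 3).Adelic), νG.IsHaarMeasure → νG.IsMulRightInvariant)
    {cl : (quasiSplit F E c 3).arithmeticSubgroup → ι} (hcl : IsConjInvariant cl)
    (hclN : IsUnipotentInvariantOnBorel F E c 3 cl) (i : ι)
    (hcusp : ∀ [MeasurableSpace (adelicUnipotent F E c 3)] [BorelSpace (adelicUnipotent F E c 3)]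
      [MeasurableSpace (quasiSplit F E c 3).Adelic] [BorelSpace (quasiSplit F E c 3).Adelic]
      (νG : Measure (quasiSplit F E c 3).Adelic) [νG.IsHaarMeasure]
      (ν : Measure (adelicUnipotent F E c 3)) [ν.IsHaarMeasure] (𝓕 : Set (adelicUnipotent F E c 3)),
      IsFundamentalDomain (rationalUnipotent F E c 3) 𝓕 ν →
      ∀ (f : (quasiSplit F E c 3).Adelic → ℂ), IsQuasiSplitTest F E c 3 f →
      ∃ T₁ : ℝ≥0, ∀ T : ℝ≥0, T₁ < T → ∃ D : Set (quasiSplit F E c 3).Adelic, MeasurableSet D ∧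
        (∀ g : (quasiSplit F E c 3).Adelic, ∃ β : (quasiSplit F E c 3).arithmeticSubgroup,
          β ∈ arithmeticBorel F E c 3 ∧ (β : (quasiSplit F E c 3).Adelic) * g ∈ D) ∧
        ∫⁻ g in D ∩ {g | T < borelHeight g},
          ‖kernelClass cl i f g g - kernelBorelClass ν 𝓕 cl i f g g‖ₑ ∂νG < ∞)
    [MeasurableSpace (adelicUnipotent F E c 3)] [BorelSpace (adelicUnipotent F E c 3)]
    (ν : Measure (adelicUnipotent F E c 3)) [ν.IsHaarMeasure]
    {𝓕 : Set (adelicUnipotent F E c 3)} (h𝓕 : IsFundamentalDomain (rationalUnipotent F E c 3) 𝓕 ν)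
    (μ : Measure (quasiSplit F E c 3).automorphicQuotient) [(quasiSplit F E c 3).IsAutomorphicMeasure μ]
    {f : (quasiSplit F E c 3).Adelic → ℂ} (hf : IsQuasiSplitTest F E c 3 f) :
    ∃ T₀ : ℝ≥0, ∀ T : ℝ≥0, T₀ < T →
      Integrable ((quasiSplit F E c 3).quotFun (truncatedKernelClass ν 𝓕 T cl i f)) μ := by
  classical
  haveI := secondCountableTopology_adeleRing E
  haveI := locallyCompactSpace_adeleRing' E
  haveI := t2Space_adeleRing_E₁₀ (E := E)
  haveI : T2Space (quasiSplit F E c 3).Adelic :=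
    inferInstanceAs (T2Space (adelic F E c 3 ((StdForm.antidiagonal 3).over E)))
  haveI : LocallyCompactSpace (quasiSplit F E c 3).Adelic :=
    inferInstanceAs (LocallyCompactSpace (adelic F E c 3 ((StdForm.antidiagonal 3).over E)))
  haveI : SecondCountableTopology (quasiSplit F E c 3).Adelic :=
    inferInstanceAs (SecondCountableTopology (adelic F E c 3 ((StdForm.antidiagonal 3).over E)))
  letI : MeasurableSpace (quasiSplit F E c 3).Adelic := borel _
  haveI : BorelSpace (quasiSplit F E c 3).Adelic := ⟨rfl⟩
  obtain ⟨K₀⟩ := (inferInstance : Nonempty (TopologicalSpace.PositiveCompacts (quasiSplit F E c 3).Adelic))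
  set νG : Measure (quasiSplit F E c 3).Adelic := Measure.haarMeasure K₀ with hνG
  haveI : νG.IsMulRightInvariant := hunimod νG inferInstance
  haveI : νG.IsInvInvariant := isInvInvariant_of_isMulRightInvariant νG
  have hfc : Continuous f := hf.continuous'
  have hfs : HasCompactSupport f := hf.hasCompactSupport'
  obtain ⟨T₁, hT₁⟩ := hcusp νG ν 𝓕 h𝓕 f hf
  refine ⟨max T₁ 1, fun T hT => ?_⟩
  have hT1 : 1 ≤ T := (le_max_right T₁ 1).trans hT.le
  have hT0 : 0 < T := lt_of_lt_of_le zero_lt_one hT1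
  obtain ⟨D, hDm, hDcov, hDint⟩ := hT₁ T ((le_max_left T₁ 1).trans_lt hT)
  obtain ⟨Cb, hCb⟩ := exists_forall_norm_kernelClass_le (F := F) (E := E) (c := c) (N := 3) (ι := ι)
    (ε := T⁻¹) (inv_pos.2 hT0) hfc hfs
  have hNcl : IsClosed ((adelicUnipotent F E c 3 : Set (quasiSplit F E c 3).Adelic)) := by
    change IsClosed (⇑(adelicVal F E c 3 ((StdForm.antidiagonal 3).over E)) ⁻¹'
      ((upperUnitriangular (Fin 3) (AdeleRing (𝓞 E) E) : Subgroup (GL (Fin 3) (AdeleRing (𝓞 E) E))) :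
        Set (GL (Fin 3) (AdeleRing (𝓞 E) E))))
    exact (isClosed_upperUnitriangular (R := AdeleRing (𝓞 E) E)).preimage continuous_subtype_val
  haveI : SecondCountableTopology (adelicUnipotent F E c 3) := TopologicalSpace.Subtype.secondCountableTopology _
  haveI : LocallyCompactSpace (adelicUnipotent F E c 3) := hNcl.locallyCompactSpace
  haveI : SFinite ν := inferInstance
  set Dψ : (quasiSplit F E c 3).Adelic → ℝ≥0∞ := (D ∩ {g | T < borelHeight g}).indicator
    fun g => (‖kernelClass cl i f g g - kernelBorelClass ν 𝓕 cl i f g g‖ₑ : ℝ≥0∞) with hDψ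
  have hDψm : Measurable Dψ := by
    have hk : Measurable fun g : (quasiSplit F E c 3).Adelic => kernelClass cl i f g g :=
      measurable_kernelClass_diag cl i hfc
    exact ((hk.sub (measurable_kernelBorelClass_diag hfc ν 𝓕 cl i)).enorm).indicator
      (hDm.inter (measurableSet_setOf_lt_borelHeight T))
  haveI hΓd : DiscreteTopology (quasiSplit F E c 3).quotientSubgroup := by
    rw [quotientSubgroup_quasiSplit]; exact isDiscreteRational_quasiSplit
  set eΓ : (quasiSplit F E c 3).quotientSubgroup ≃ (quasiSplit F E c 3).arithmeticSubgroup :=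
    (MulEquiv.subgroupCongr (quotientSubgroup_quasiSplit (F := F) (E := E) (c := c) (N := 3))).toEquiv with heΓ
  have hpt : ∀ y : (quasiSplit F E c 3).Adelic, (‖truncatedKernelClass ν 𝓕 T cl i f y‖ₑ : ℝ≥0∞) ≤
      ENNReal.ofReal Cb + ∑' γ : (quasiSplit F E c 3).quotientSubgroup,
        Dψ ((γ : (quasiSplit F E c 3).Adelic) * y) := by
    intro y
    have h := enorm_truncatedKernelClass_le_of_dichotomy hc ν h𝓕 hcl hclN i f hT1 (hCb cl i) hDcov y
    have hre : ∑' γ : (quasiSplit F E c 3).arithmeticSubgroup, Dψ ((γ : (quasiSplit F E c 3).Adelic) * y) =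
        ∑' γ : (quasiSplit F E c 3).quotientSubgroup, Dψ ((γ : (quasiSplit F E c 3).Adelic) * y) := by
      rw [← eΓ.tsum_eq]; rfl
    rw [← hre]
    exact h
  letI : MeasurableSpace ((quasiSplit F E c 3).Adelic ⧸ (quasiSplit F E c 3).quotientSubgroup) :=
    AdelicGroupData.measurableSpaceQuotientForm (quasiSplit F E c 3)
  haveI : BorelSpace ((quasiSplit F E c 3).Adelic ⧸ (quasiSplit F E c 3).quotientSubgroup) :=
    AdelicGroupData.borelSpaceQuotientForm (quasiSplit F E c 3)
  haveI : SMulInvariantMeasure (quasiSplit F E c 3).Adelic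
      ((quasiSplit F E c 3).Adelic ⧸ (quasiSplit F E c 3).quotientSubgroup) μ :=
    AdelicGroupData.smulInvariantMeasureQuotientForm (quasiSplit F E c 3) μ
  haveI : @IsFiniteMeasureOnCompacts ((quasiSplit F E c 3).Adelic ⧸ (quasiSplit F E c 3).quotientSubgroup) _ _ μ :=
    AdelicGroupData.isFiniteMeasureOnCompactsQuotientForm (quasiSplit F E c 3) μ
  have hfib : ∀ x : (quasiSplit F E c 3).automorphicQuotient,
      ∑' γ : (quasiSplit F E c 3).quotientSubgroup,
          Dψ ((γ : (quasiSplit F E c 3).Adelic) * (Quotient.out x)⁻¹) =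
        fiberLIntegral (quasiSplit F E c 3).quotientSubgroup count (Dψ ∘ fun g => g⁻¹) x := by
    intro x
    conv_rhs => rw [← QuotientGroup.out_eq' x]
    rw [LevelOrbit.fiberLIntegral_count_mk]
    rw [← (Equiv.inv (quasiSplit F E c 3).quotientSubgroup).tsum_eq]
    refine tsum_congr fun γ => ?_
    simp only [Equiv.inv_apply, Function.comp_apply, Subgroup.coe_inv, _root_.mul_inv_rev]
  have hqf : ∀ x : (quasiSplit F E c 3).automorphicQuotient,
      (quasiSplit F E c 3).quotFun (truncatedKernelClass ν 𝓕 T cl i f) x =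
        truncatedKernelClass ν 𝓕 T cl i f (Quotient.out x)⁻¹ := by
    intro x
    have h := quotFun_truncatedKernelClass_toAutomorphicQuotient' hcl hclN ν h𝓕 T i f (Quotient.out x)
    rw [show (quasiSplit F E c 3).toAutomorphicQuotient (Quotient.out x) = x from QuotientGroup.out_eq' x] at h
    exact h
  have hlin : ∫⁻ x, (‖(quasiSplit F E c 3).quotFun (truncatedKernelClass ν 𝓕 T cl i f) x‖ₑ : ℝ≥0∞) ∂μ ≤
      ENNReal.ofReal Cb * μ Set.univ +
        unfoldingConstant (quasiSplit F E c 3).quotientSubgroup count μ νG *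
          ∫⁻ g in D ∩ {g | T < borelHeight g},
            ‖kernelClass cl i f g g - kernelBorelClass ν 𝓕 cl i f g g‖ₑ ∂νG := by
    calc ∫⁻ x, (‖(quasiSplit F E c 3).quotFun (truncatedKernelClass ν 𝓕 T cl i f) x‖ₑ : ℝ≥0∞) ∂μ
        ≤ ∫⁻ x, (ENNReal.ofReal Cb +
            fiberLIntegral (quasiSplit F E c 3).quotientSubgroup count (Dψ ∘ fun g => g⁻¹) x) ∂μ := by
          refine lintegral_mono fun x => ?_
          rw [← hfib x, hqf x]
          exact hpt _
      _ = ENNReal.ofReal Cb * μ Set.univ +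
          ∫⁻ x, fiberLIntegral (quasiSplit F E c 3).quotientSubgroup count (Dψ ∘ fun g => g⁻¹) x ∂μ := by
          rw [lintegral_add_left measurable_const, lintegral_const]
      _ = ENNReal.ofReal Cb * μ Set.univ +
          unfoldingConstant (quasiSplit F E c 3).quotientSubgroup count μ νG * ∫⁻ g, (Dψ ∘ fun g => g⁻¹) g ∂νG := by
          have hW := LevelOrbit.lintegral_fiberLIntegral_count_eq (quasiSplit F E c 3).quotientSubgroup μ νG
            (hDψm.comp measurable_inv)
          exact congrArg (fun t => ENNReal.ofReal Cb * μ Set.univ + t) hW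
      _ = ENNReal.ofReal Cb * μ Set.univ +
          unfoldingConstant (quasiSplit F E c 3).quotientSubgroup count μ νG * ∫⁻ g, Dψ g ∂νG := by
          congr 2
          exact lintegral_inv_eq_self Dψ
      _ = _ := by
          congr 2
          rw [hDψ, lintegral_indicator (hDm.inter (measurableSet_setOf_lt_borelHeight T))]
  have hfin : ∫⁻ x, (‖(quasiSplit F E c 3).quotFun (truncatedKernelClass ν 𝓕 T cl i f) x‖ₑ : ℝ≥0∞) ∂μ < ∞ := by
    refine lt_of_le_of_lt hlin ?_
    refine ENNReal.add_lt_top.2 ⟨ENNReal.mul_lt_top ENNReal.ofReal_lt_top (measure_lt_top μ _), ?_⟩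
    exact ENNReal.mul_lt_top ENNReal.coe_lt_top hDint
  exact ⟨aestronglyMeasurable_quotFun_truncatedKernelClass hcl hclN hfc ν h𝓕 hT0 i μ, hfin⟩

end UnitaryGroup

end Literature.NumberTheory.Automorphic
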